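import Literature.Probability.LatticeModels.MeanFieldDifferentialInequality
import HarnessLib

/-!
# Ghost-avoiding two-point current sums: `∑_k θ_{kg} G♭(u,k) ≤ Z(u g)` (a current analogue of Aizenman–Fernández's kernel bounds)

Topic `Probability/LatticeModels`, namespace `Literature.Probability.LatticeModels`. Sequel of
`FieldCurrents` / `MeanFieldDifferentialInequality` (currents on the edges `ℰ⁺_Λ` of the ghost
graph `ghostGraph G Λ` with edge-dependent couplings `θ ≥ 0`, generating sums `gcurrentZ`, pair
sums `currentPairSum`, the random-current representation with field
`isingCorr_free_eq_gcurrentZ_div`).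

Aizenman–Fernández 1986 (J. Stat. Phys. 44, 393–454) control the magnetisation through a kernel
`K(x,y)` of their random-WALK expansion (Def. 4.5, eq. (4.16): the currents with sources `{x,y}`
whose `x`-backbone reaches `y` before any `h`-site), with the two key bounds
`⟨σₓ;σ_y⟩ ≤ K(x,y) ≤ ⟨σₓσ_y⟩_{h=0}` (Prop. 4.7, (4.22)) and
`∑_y K(x,y) tanh(βh_y)/(1 + ⟨σ_y⟩ tanh(βh_y)) ≤ ⟨σₓ⟩` (Prop. 4.8, (4.24); (4.26) in the
translation-invariant case: `∑_y K(x,y) ≤ (M/tanh(βh))(1 + M tanh(βh))`). This file introduces a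
purely random-CURRENT substitute that needs no backbone: the **ghost-avoiding two-point sum**

  `G♭_θ(u,k) · Z := ∑_{∂n = {u} Δ {k}} w_θ(n) 𝟙[u ↮ g in n]`      (`gAvoidZ`)

(one current with sources `{u,k}` whose cluster of `u` contains no charged ghost edge), and proves
for it the analogue of (4.24)/(4.26) and of the left half of (4.22):

* `sum_ghost_mul_gAvoidZ_le` — **`∑_{k ∈ Λ} θ_{kg} · G♭(u,k) Z ≤ Z({u} Δ {g})`**, i.e. for uniform
  field coupling `θ_{kg} = βh`: `∑_k G♭(u,k) ≤ ⟨σ_u⟩/(βh)` (`sum_gAvoid_le_isingCorr_div`). Proof: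
  on the support the ghost edge `{k,g}` is uncharged (`k` lies in the ghost-free cluster of `u`),
  and `(k, n) ↦ n + 𝟙_{{k,g}}` is an injection into the currents with sources `{u,g}` multiplying
  the weight by `θ_{kg}` — injective because `k` is recovered as the unique vertex of the cluster
  of `u` carrying a charged ghost edge (`gAvoid_injective`).
* `isingCorr_pair_sub_le_gAvoid` — **`⟨σ_uσ_k⟩ - ⟨σ_u⟩⟨σ_k⟩ ≤ G♭(u,k)`** (free state with field `h`,
  tree parametrisation): the double-current representation of the truncated pair function
  (`isingCorr_pair_sub_eq`, `𝟙[u ↮ g in n₁+n₂]`) and `𝟙[u ↮ g in n₁+n₂] ≤ 𝟙[u ↮ g in n₁]`.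

These are the two properties of `K` that the proof of Aizenman–Fernández's Thm. 5.7 (b) uses
outside Lemma 5.5 / Thm. 5.6, and they are what the walk-free estimate of the second-order
dilution term in the sibling files rests on. (The analogue of the right half of (4.22),
`G♭(u,k) ≤ ⟨σ_uσ_k⟩_{h=0}`, also holds — cluster decomposition and supermodularity of `log Z`,
Aizenman–Fernández (4.13)–(4.15) — but is not needed and not proved here.)

## References

* M. Aizenman, R. Fernández, J. Stat. Phys. **44** (1986) 393–454, §4.3: Def. 4.5, (4.16);
  Prop. 4.7, (4.22); Prop. 4.8, (4.24)–(4.26), pp. 422–424 [AizenmanFernandezJSP1986]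
  (held: author copy `paper:url-b8cebc3f44bb`, PDF page = journal page − 392).
* H. Duminil-Copin, V. Tassion, CMP **343** (2016) 725, §2.3, eq. (2.2) (arXiv:1502.03050
  numbering) [DuminilCopinTassionCMP2016].

## Mathlib

`ENNReal.tsum_comp_le_tsum_of_injective`, `tsum_subtype_eq_of_support_subset`,
`ENNReal.tsum_prod`, `ENNReal.tsum_mul_left`, `Function.update` algebra,
`Relation.ReflTransGen` induction.
-/

noncomputable section

open Finset MeasureTheory
open scoped symmDiff ENNReal

namespace Literature.Probability.LatticeModels

variable {V : Type*} [DecidableEq V]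

section Kernel

variable {G : SimpleGraph V} [G.LocallyFinite] {Λ : Finset V}

local notation "Gg" => ghostGraph G Λ
local notation "Λg" => Finset.insertNone Λ
local notation "Eg" => edgesIn (ghostGraph G Λ) (Finset.insertNone Λ)
local notation "Zg[" θ ", " X "]" =>
  gcurrentZ (ghostGraph G Λ) (Finset.insertNone Λ) θ (edgesIn (ghostGraph G Λ) (Finset.insertNone Λ)) X
local notation "Conn[" m ", " u ", " v "]" =>
  CConn (ghostGraph G Λ) (Finset.insertNone Λ) m (edgesIn (ghostGraph G Λ) (Finset.insertNone Λ)) u v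
local notation "∂g" => csources (ghostGraph G Λ) (Finset.insertNone Λ)

/-! ### The ghost-avoiding two-point sum -/

variable (G Λ) in
/-- **The ghost-avoiding two-point current sum** `G♭_θ(u,k)·Z = ∑_{∂n = {u} Δ {k}} w_θ(n) 𝟙[u ↮ g in n]`:
currents on `ℰ⁺_Λ` with sources `{u} Δ {k}` (lattice sources only) in which the cluster of `u`
carries no charged ghost edge — the random-current counterpart of the kernel `K(u,k)` of
Aizenman–Fernández 1986 (Def. 4.5, (4.16): the `u`-backbone reaches `k` before any `h`-site). [cite: AizenmanFernandezJSP1986, §4.3, Definition 4.5, eq. (4.16), p. 422] -/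
def gAvoidZ (θ : Sym2 (Option V) → ℝ) (u k : V) : ℝ≥0∞ :=
  ∑' n : Eg → ℕ, ind (∂g n = ({some u} ∆ {some k} : Finset (Option V)) ∧ ¬Conn[n, some u, none]) *
    gweight Gg Λg θ n

/-- Dropping the ghost-avoidance: `G♭(u,k)·Z ≤ Z({u} Δ {k})`. [folklore] -/
theorem gAvoidZ_le (θ : Sym2 (Option V) → ℝ) (u k : V) :
    gAvoidZ G Λ θ u k ≤ Zg[θ, {some u} ∆ {some k}] := by
  unfold gAvoidZ gcurrentZ
  exact ENNReal.tsum_le_tsum fun n => mul_le_mul_left (ind_mono fun h => ⟨h.1, csupp_edgesIn n⟩) _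

/-- `G♭(u,k)·Z < ∞` for `θ ≥ 0`. [folklore] -/
theorem gAvoidZ_ne_top {θ : Sym2 (Option V) → ℝ} (hθ : ∀ e, 0 ≤ θ e) (u k : V) :
    gAvoidZ G Λ θ u k ≠ ∞ :=
  ne_top_of_le_ne_top (gcurrentZ_ne_top hθ subset_rfl _) (gAvoidZ_le θ u k)

/-! ### The ghost edge at a vertex of `Λ` as an edge of `ℰ⁺_Λ` -/

/-- The ghost edge `{k, g}` is an edge of the ghost graph inside `Λ ∪ {g}` for `k ∈ Λ`. [folklore] -/
theorem ghostEdge_mem_edgesIn {k : V} (hk : k ∈ Λ) : ghostEdge k ∈ Eg :=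
  map_ghostEdge_subset_edgesIn (subset_refl Λ) (mem_map_of_mem _ hk)

/-- The ghost edge `{k, g}`, `k ∈ Λ`, as an element of `ℰ⁺_Λ`. [folklore] -/
def ghostEdgeIn {k : V} (hk : k ∈ Λ) : Eg := ⟨ghostEdge k, ghostEdge_mem_edgesIn hk⟩

/-- `ghostEdgeIn hk` is the pair `{k, g}`. [folklore] -/
@[simp] theorem coe_ghostEdgeIn {k : V} (hk : k ∈ Λ) : ((ghostEdgeIn hk : Eg) : Sym2 (Option V)) = s(some k, none) :=
  rfl

/-- Distinct vertices have distinct ghost edges. [folklore] -/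
theorem ghostEdgeIn_injective {k k' : V} (hk : k ∈ Λ) (hk' : k' ∈ Λ)
    (h : (ghostEdgeIn (G := G) hk : Eg) = ghostEdgeIn (G := G) hk') : k = k' := by
  have := congrArg (fun e : Eg => (e : Sym2 (Option V))) h
  simp only [coe_ghostEdgeIn] at this
  exact ghostEdge.injective this

/-- The endpoints of the ghost edge `{k, g}` inside `Λ ∪ {g}` are `{k} Δ {g}`. [folklore] -/
theorem filter_mem_ghostEdge_eq {k : V} (hk : k ∈ Λ) :
    (Λg).filter (· ∈ ((ghostEdgeIn hk : Eg) : Sym2 (Option V))) = ({some k} ∆ {none} : Finset (Option V)) := by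
  rw [coe_ghostEdgeIn, filter_mem_edge_eq (G := ghostGraph G Λ) (Λ := Λg) (x := some k) (y := none)
    (ghostEdge_mem_edgesIn hk), pair_eq_symmDiff (Option.some_ne_none k), symmDiff_comm]

/-- A charged ghost edge `{k, g}` joins `k` to the ghost. [folklore] -/
theorem cconn_some_none_of_pos {n : Eg → ℕ} {k : V} (hk : k ∈ Λ) (hpos : 0 < n (ghostEdgeIn hk)) :
    Conn[n, some k, none] :=
  Relation.ReflTransGen.single ⟨ghostEdgeIn hk, ghostEdge_mem_edgesIn hk, hpos, rfl⟩

/-! ### On the support: the ghost edge at `k` is uncharged -/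

/-- Sources `{u} Δ {k}` connect `u` to `k` (trivially if `u = k`). [folklore] -/
theorem cconn_of_csources_eq_pair {n : Eg → ℕ} {u k : V}
    (hsrc : ∂g n = ({some u} ∆ {some k} : Finset (Option V))) : Conn[n, some u, some k] := by
  by_cases huk : u = k
  · subst huk; exact Relation.ReflTransGen.refl
  · exact cconn_of_csources_eq (fun h => huk (Option.some_injective _ h)) hsrc

/-- In a current with sources `{u} Δ {k}` whose cluster of `u` avoids the ghost, the ghost edge at
`k` is uncharged. [folklore] -/
theorem apply_ghostEdgeIn_eq_zero {n : Eg → ℕ} {u k : V} (hk : k ∈ Λ)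
    (hsrc : ∂g n = ({some u} ∆ {some k} : Finset (Option V))) (havoid : ¬Conn[n, some u, none]) :
    n (ghostEdgeIn hk) = 0 := by
  by_contra hne
  exact havoid ((cconn_of_csources_eq_pair hsrc).trans (cconn_some_none_of_pos hk (Nat.pos_of_ne_zero hne)))

/-! ### The injection `(k, n) ↦ n + 𝟙_{{k,g}}` -/

/-- Connections of `u` in `n₂` survive in `n₁` unless they pass through the ghost, when
`n₁ + 𝟙_{e₁} = n₂ + 𝟙_{e₂}` for the ghost edges `e₁ = {k₁,g}`, `e₂ = {k₂,g}`:
`u ↔ v` in `n₂` implies `u ↔ v` in `n₁` or `u ↔ g` in `n₂`. [folklore] -/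
theorem cconn_transfer {n₁ n₂ : Eg → ℕ} {k₁ k₂ : V} (hk₁ : k₁ ∈ Λ) (hk₂ : k₂ ∈ Λ)
    (heq : Function.update n₁ (ghostEdgeIn hk₁) 1 = Function.update n₂ (ghostEdgeIn hk₂) 1)
    {u : V} {v : Option V} (hconn : Conn[n₂, some u, v]) :
    Conn[n₁, some u, v] ∨ Conn[n₂, some u, none] := by
  induction hconn with
  | refl => exact Or.inl Relation.ReflTransGen.refl
  | @tail a b hua hab ih =>
    rcases ih with h | h
    · obtain ⟨e, he, hpos, hes⟩ := hab
      by_cases hee : e = ghostEdgeIn hk₁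
      · -- the step uses the ghost edge `{k₁, g}`: one of its ends is the ghost
        subst hee
        have hes' : s(some k₁, (none : Option V)) = s(a, b) := hes
        rcases Sym2.eq_iff.1 hes' with ⟨-, hb⟩ | ⟨-, hb⟩
        · -- `a = some k₁`, `b = none`
          have := hua.tail ⟨ghostEdgeIn hk₁, he, hpos, hes⟩
          rw [← hb] at this
          exact Or.inr this
        · -- `a = none`
          rw [← hb] at hua
          exact Or.inr hua
      · -- any other charged edge of `n₂` is charged in `n₁`
        have hn₁ : n₁ e = Function.update n₂ (ghostEdgeIn hk₂) 1 e := by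
          rw [← heq, Function.update_of_ne hee]
        have hpos₁ : 0 < n₁ e := by
          rw [hn₁]
          by_cases hee₂ : e = ghostEdgeIn hk₂
          · subst hee₂; rw [Function.update_self]; exact one_pos
          · rw [Function.update_of_ne hee₂]; exact hpos
        exact Or.inl (h.tail ⟨e, he, hpos₁, hes⟩)
    · exact Or.inr h

/-- **Injectivity**: if `nᵢ` has sources `{u} Δ {kᵢ}` and a ghost-free cluster of `u` (`i = 1,2`)
and `n₁ + 𝟙_{{k₁,g}} = n₂ + 𝟙_{{k₂,g}}`, then `k₁ = k₂` and `n₁ = n₂` (`k` is the unique vertex of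
the cluster of `u` carrying a charged ghost edge). [folklore] -/
theorem gAvoid_injective {n₁ n₂ : Eg → ℕ} {u k₁ k₂ : V} (hk₁ : k₁ ∈ Λ) (hk₂ : k₂ ∈ Λ)
    (hsrc₁ : ∂g n₁ = ({some u} ∆ {some k₁} : Finset (Option V))) (hav₁ : ¬Conn[n₁, some u, none])
    (hsrc₂ : ∂g n₂ = ({some u} ∆ {some k₂} : Finset (Option V))) (hav₂ : ¬Conn[n₂, some u, none])
    (heq : Function.update n₁ (ghostEdgeIn hk₁) 1 = Function.update n₂ (ghostEdgeIn hk₂) 1) :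
    k₁ = k₂ ∧ n₁ = n₂ := by
  have h₁ := apply_ghostEdgeIn_eq_zero hk₁ hsrc₁ hav₁
  have h₂ := apply_ghostEdgeIn_eq_zero hk₂ hsrc₂ hav₂
  have hk : k₁ = k₂ := by
    by_contra hne
    have hne' : (ghostEdgeIn hk₁ : Eg) ≠ ghostEdgeIn hk₂ := fun h => hne (ghostEdgeIn_injective hk₁ hk₂ h)
    -- in `n₁` the ghost edge at `k₂` is charged
    have hpos : 0 < n₁ (ghostEdgeIn hk₂) := by
      have : n₁ (ghostEdgeIn hk₂) = Function.update n₂ (ghostEdgeIn hk₂) 1 (ghostEdgeIn hk₂) := by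
        rw [← heq, Function.update_of_ne hne'.symm]
      rw [this, Function.update_self]; exact one_pos
    -- and `u ↔ k₂` in `n₁` (transferred from `n₂`), hence `u ↔ g` in `n₁`
    rcases cconn_transfer hk₁ hk₂ heq (cconn_of_csources_eq_pair hsrc₂) with h | h
    · exact hav₁ (h.trans (cconn_some_none_of_pos hk₂ hpos))
    · exact hav₂ h
  subst hk
  refine ⟨rfl, ?_⟩
  have := congrArg (fun n => Function.update n (ghostEdgeIn hk₁) 0) heq
  simp only [Function.update_idem] at this
  rwa [Function.update_eq_self_iff.2 h₁.symm, Function.update_eq_self_iff.2 h₂.symm] at this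

/-! ### The bound `∑_k θ_{kg} G♭(u,k) Z ≤ Z({u} Δ {g})` -/

/-- The image current `n + 𝟙_{{k,g}}` of a ghost-avoiding current with sources `{u} Δ {k}` has
sources `{u} Δ {g}` and weight `θ_{kg} w(n)`. [folklore] -/
theorem gAvoid_image {θ : Sym2 (Option V) → ℝ} {n : Eg → ℕ} {u k : V} (hk : k ∈ Λ)
    (hsrc : ∂g n = ({some u} ∆ {some k} : Finset (Option V))) (havoid : ¬Conn[n, some u, none]) :
    ∂g (Function.update n (ghostEdgeIn hk) 1) = ({some u} ∆ {none} : Finset (Option V)) ∧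
      gweight Gg Λg θ (Function.update n (ghostEdgeIn hk) 1) =
        ENNReal.ofReal (θ (ghostEdge k)) * gweight Gg Λg θ n := by
  have h0 := apply_ghostEdgeIn_eq_zero hk hsrc havoid
  constructor
  · rw [csources_update h0 1, if_pos odd_one, hsrc, filter_mem_ghostEdge_eq hk, symmDiff_assoc,
      symmDiff_symmDiff_cancel_left]
  · rw [gweight_update h0 θ 1]
    congr 1
    simp [edgeWeight]

/-- **The ghost-insertion bound** (random-current analogue of Aizenman–Fernández 1986, Prop. 4.8,
(4.24)/(4.26)): for `θ ≥ 0` and `u ∈ Λ`,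
`∑_{k ∈ Λ} θ_{kg} · (∑_{∂n = {u} Δ {k}} w_θ(n) 𝟙[u ↮ g in n]) ≤ Z_θ({u} Δ {g})`.
The map `(k, n) ↦ n + 𝟙_{{k,g}}` is an injection of the support into the currents with sources
`{u} Δ {g}` (`gAvoid_injective`) multiplying the weight by `θ_{kg}` (`gAvoid_image`). [cite: AizenmanFernandezJSP1986, §4.3, Proposition 4.8, eqs. (4.24)–(4.26), pp. 423–424] -/
theorem sum_ghost_mul_gAvoidZ_le (θ : Sym2 (Option V) → ℝ) {u : V} :
    ∑ k ∈ Λ, ENNReal.ofReal (θ (ghostEdge k)) * gAvoidZ G Λ θ u k ≤ Zg[θ, {some u} ∆ {none}] := by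
  classical
  -- the summand as a function of `(k, n)` with `k : Λ`
  set P : (↥Λ × (Eg → ℕ)) → Prop := fun p =>
    ∂g p.2 = ({some u} ∆ {some (p.1 : V)} : Finset (Option V)) ∧ ¬Conn[p.2, some u, none] with hP
  set F : (↥Λ × (Eg → ℕ)) → ℝ≥0∞ := fun p =>
    ENNReal.ofReal (θ (ghostEdge (p.1 : V))) * (ind (P p) * gweight Gg Λg θ p.2) with hF
  set g : (Eg → ℕ) → ℝ≥0∞ := fun m =>
    ind (∂g m = ({some u} ∆ {none} : Finset (Option V)) ∧ CSupp Gg Λg Eg m) * gweight Gg Λg θ m with hg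
  -- rewrite the left-hand side as a `tsum` over `Λ × (Eg → ℕ)`
  have hL : ∑ k ∈ Λ, ENNReal.ofReal (θ (ghostEdge k)) * gAvoidZ G Λ θ u k = ∑' p : ↥Λ × (Eg → ℕ), F p := by
    rw [ENNReal.tsum_prod', tsum_fintype, ← Finset.sum_coe_sort Λ]
    refine Finset.sum_congr rfl fun k _ => ?_
    simp only [hF, gAvoidZ]
    rw [← ENNReal.tsum_mul_left]
  rw [hL]
  -- restrict to the support
  have hsupp : Function.support F ⊆ {p | P p} := by
    intro p hp
    by_contra hnp
    have hnp' : ¬P p := hnp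
    apply hp
    show ENNReal.ofReal (θ (ghostEdge (p.1 : V))) * (ind (P p) * gweight Gg Λg θ p.2) = 0
    rw [ind_of_false hnp', zero_mul, mul_zero]
  rw [← tsum_subtype_eq_of_support_subset hsupp]
  -- the injection
  set Φ : {p : ↥Λ × (Eg → ℕ) // P p} → (Eg → ℕ) := fun t =>
    Function.update t.1.2 (ghostEdgeIn t.1.1.2) 1 with hΦ
  have hΦinj : Function.Injective Φ := by
    rintro ⟨⟨⟨k₁, hk₁⟩, n₁⟩, hP₁⟩ ⟨⟨⟨k₂, hk₂⟩, n₂⟩, hP₂⟩ h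
    obtain ⟨hk, hn⟩ := gAvoid_injective hk₁ hk₂ hP₁.1 hP₁.2 hP₂.1 hP₂.2 h
    subst hk; subst hn; rfl
  -- pointwise comparison with `g ∘ Φ`
  have hle : ∀ t : {p : ↥Λ × (Eg → ℕ) // P p}, F t ≤ g (Φ t) := by
    rintro ⟨⟨⟨k, hk⟩, n⟩, hPt⟩
    obtain ⟨hsrc', hw'⟩ := gAvoid_image (θ := θ) hk hPt.1 hPt.2
    simp only [hF, hg, hΦ, ind_of_true hPt, one_mul]
    rw [ind_of_true ⟨hsrc', csupp_edgesIn _⟩, one_mul, hw']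
  calc ∑' t : {p : ↥Λ × (Eg → ℕ) // P p}, F t ≤ ∑' t : {p : ↥Λ × (Eg → ℕ) // P p}, g (Φ t) :=
        ENNReal.tsum_le_tsum hle
    _ ≤ ∑' m : Eg → ℕ, g m := ENNReal.tsum_comp_le_tsum_of_injective hΦinj g
    _ = Zg[θ, {some u} ∆ {none}] := rfl

/-- **Real-valued form for the free Ising state with field** (tree parametrisation, couplings
`β` and `βh` on the ghost graph): for `β ≥ 0`, `h > 0`, `u ∈ Λ`,
`∑_{k ∈ Λ} G♭(u,k) ≤ ⟨σ_u⟩^∅_{Λ;β,h} / (βh)`, `G♭(u,k) = (∑_{∂n={u}Δ{k}} w(n) 𝟙[u ↮ g]) / Z(∅)`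
(Aizenman–Fernández 1986, (4.26): `∑_y K(x,y) ≤ (M/tanh(βh))(1 + M tanh(βh))` for the walk kernel). [cite: AizenmanFernandezJSP1986, §4.3, Proposition 4.8, eq. (4.26), p. 424] -/
theorem sum_gAvoid_le_isingCorr_div {β h : ℝ} (hβ : 0 < β) (hh : 0 < h) {u : V} (hu : u ∈ Λ) :
    ∑ k ∈ Λ, (gAvoidZ G Λ (ghostCoupling β (β * h)) u k).toReal /
        (Zg[ghostCoupling β (β * h), ∅]).toReal ≤
      isingCorr G Λ β h .free {u} / (β * h) := by
  set θ : Sym2 (Option V) → ℝ := ghostCoupling β (β * h) with hθdef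
  have hθ : ∀ e, 0 ≤ θ e := fun e => ghostCoupling_nonneg hβ.le (mul_nonneg hβ.le hh.le) e
  have hβh : 0 < β * h := mul_pos hβ hh
  have hZpos : 0 < (Zg[θ, ∅]).toReal := toReal_gcurrentZ_ghost_empty_pos subset_rfl hθ subset_rfl
  have hmain := sum_ghost_mul_gAvoidZ_le (G := G) (Λ := Λ) θ (u := u)
  have hcoup : ∀ k ∈ Λ, ENNReal.ofReal (θ (ghostEdge k)) = ENNReal.ofReal (β * h) := fun k _ => by
    rw [hθdef, ghostCoupling_ghostEdge]
  rw [Finset.sum_congr rfl fun k hk => by rw [hcoup k hk], ← Finset.mul_sum] at hmain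
  -- pass to real numbers
  have hfin : ∀ k ∈ Λ, gAvoidZ G Λ θ u k ≠ ∞ := fun k _ => gAvoidZ_ne_top hθ u k
  have hsum_ne : ∑ k ∈ Λ, gAvoidZ G Λ θ u k ≠ ∞ := ENNReal.sum_ne_top.2 hfin
  have hR := (ENNReal.toReal_le_toReal (ENNReal.mul_ne_top ENNReal.ofReal_ne_top hsum_ne)
    (gcurrentZ_ne_top hθ subset_rfl _)).2 hmain
  rw [ENNReal.toReal_mul, ENNReal.toReal_ofReal hβh.le, ENNReal.toReal_sum hfin] at hR
  -- `⟨σ_u⟩ = Z({u}Δ{g}) / Z(∅)`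
  have hcorr : isingCorr G Λ β h .free {u} = (Zg[θ, {some u} ∆ {none}]).toReal / (Zg[θ, ∅]).toReal := by
    rw [isingCorr_free_eq_gcurrentZ_div subset_rfl hβ.le hh.le (singleton_subset_iff.2 hu), starSet_singleton]
  rw [hcorr, ← Finset.sum_div, div_div, div_le_div_iff₀ hZpos (mul_pos hZpos hβh)]
  calc (∑ k ∈ Λ, (gAvoidZ G Λ θ u k).toReal) * ((Zg[θ, ∅]).toReal * (β * h))
      = (β * h * ∑ k ∈ Λ, (gAvoidZ G Λ θ u k).toReal) * (Zg[θ, ∅]).toReal := by ring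
    _ ≤ (Zg[θ, {some u} ∆ {none}]).toReal * (Zg[θ, ∅]).toReal :=
        mul_le_mul_of_nonneg_right hR hZpos.le

/-! ### The truncated pair function is at most `G♭` -/

/-- **`⟨σ_uσ_k⟩ - ⟨σ_u⟩⟨σ_k⟩ ≤ G♭(u,k)`** for the free Ising state with field (`β ≥ 0`, `h ≥ 0`,
`u, k ∈ Λ`): by the double-current representation of the truncated pair function
(`isingCorr_pair_sub_eq`: `Z⁻² ∑_{∂n₁={u}Δ{k}, ∂n₂=∅} w w 𝟙[u ↮ g in n₁+n₂]`) and
`𝟙[u ↮ g in n₁+n₂] ≤ 𝟙[u ↮ g in n₁]` — the random-current counterpart of the left half of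
Aizenman–Fernández 1986, (4.22), `⟨σₓ;σ_y⟩ ≤ K(x,y)`. [cite: AizenmanFernandezJSP1986, §4.3, Proposition 4.7, eq. (4.22), p. 423] -/
theorem isingCorr_pair_sub_le_gAvoid {β h : ℝ} (hβ : 0 ≤ β) (hh : 0 ≤ h) {u k : V} (hu : u ∈ Λ)
    (hk : k ∈ Λ) :
    isingCorr G Λ β h .free ({u} ∆ {k}) - isingCorr G Λ β h .free {u} * isingCorr G Λ β h .free {k} ≤
      (gAvoidZ G Λ (ghostCoupling β (β * h)) u k).toReal /
        (Zg[ghostCoupling β (β * h), ∅]).toReal := by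
  set θ : Sym2 (Option V) → ℝ := ghostCoupling β (β * h) with hθdef
  have hθ : ∀ e, 0 ≤ θ e := fun e => ghostCoupling_nonneg hβ (mul_nonneg hβ hh) e
  have hZpos : 0 < (Zg[θ, ∅]).toReal := toReal_gcurrentZ_ghost_empty_pos subset_rfl hθ subset_rfl
  rw [isingCorr_pair_sub_eq hβ hh hu hk, starSet_pair]
  -- the pair sum is at most `G♭·Z · Z`
  have hle : currentPairSum G Λ θ ({some u} ∆ {some k}) ∅ (fun m => ind (¬Conn[m, some u, none])) ≤
      gAvoidZ G Λ θ u k * Zg[θ, ∅] := by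
    unfold currentPairSum gAvoidZ gcurrentZ
    rw [tsum_mul_tsum_eq_tsum_prod]
    refine ENNReal.tsum_le_tsum fun p => ?_
    dsimp only
    by_cases h1 : ∂g p.1 = ({some u} ∆ {some k} : Finset (Option V)) ∧ CSupp Gg Λg Eg p.1
    · by_cases h2 : ∂g p.2 = (∅ : Finset (Option V)) ∧ CSupp Gg Λg Eg p.2
      · by_cases hc : Conn[p.1 + p.2, some u, none]
        · rw [ind_of_false (not_not.2 hc), mul_zero, mul_zero]
          exact zero_le
        · have hc1 : ¬Conn[p.1, some u, none] := fun h => hc (h.mono fun e => Nat.le_add_right _ _)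
          rw [ind_of_true h1, ind_of_true h2, ind_of_true hc, ind_of_true ⟨h1.1, hc1⟩]
          simp only [one_mul, mul_one]
          exact le_rfl
      · rw [ind_of_false h2]; simp
    · rw [ind_of_false h1]; simp
  have hfinG : gAvoidZ G Λ θ u k ≠ ∞ := gAvoidZ_ne_top hθ u k
  have hfinZ : Zg[θ, ∅] ≠ ∞ := gcurrentZ_ne_top hθ subset_rfl _
  have hR := (ENNReal.toReal_le_toReal (currentPairSum_ne_top hθ _ _ fun _ => ind_le_one _)
    (ENNReal.mul_ne_top hfinG hfinZ)).2 hle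
  rw [ENNReal.toReal_mul] at hR
  rw [div_le_div_iff₀ (pow_pos hZpos 2) hZpos]
  nlinarith [hR, hZpos]

end Kernel

end Literature.Probability.LatticeModels
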